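import Literature.NumberTheory.Sieve.VinogradovExpSumTools
import HarnessLib

/-!
# A discrete smooth cutoff with polynomially decaying exponential sums
# (Bourgain 2013, §2, "a smoothened `m`-summation", (2.11)) — proved

Topic `Literature/NumberTheory/LFunctions`, a proofs companion of `MoebiusWalshCircuits.lean`
(named facts `bourgain_moebius_walsh_uniform`, `bourgain_liouville_walsh_uniform`: J. Bourgain,
*Möbius–Walsh correlation bounds and an estimate of Mauduit and Rivat*, J. Anal. Math. 119 (2013)
147–163 = arXiv:1109.2784, Theorem 1). Everything here is PROVED; three elementary `def`s with
bodies (`boxPoly`, `avgPoly`, `smoothCutoff`), no named fact.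

Bourgain, §2, after (2.10): "substitution of (2.5), (2.8) and applying a smoothened `m`-summation
gives for (2.3), with `M₁ = M^{1-ε₁}`, `(M²N/L) ∑ ∑_{k,k'} |ŵ(k)| |ŵ(k')| 𝟙[‖…‖ < 1/M₁]` (2.11)
up to a negligible error term." The printed proof does not say which smoothing is used. What is
needed is a weight `ψ ≥ 𝟙_{[M,2M)}` (inserted in `∑_{m∼M} |∑_n β_n w(mn)| ≤ ∑_m ψ(m) |…|` BEFORE
the Cauchy–Schwarz of (2.1)–(2.2), which is legitimate because the terms are nonnegative), with
`0 ≤ ψ ≤ 1`, supported in a slightly larger dyadic range, whose exponential sums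
`∑_m ψ(m) e(mθ)` are negligible as soon as `‖θ‖ ≥ 1/M₁`. We take the DISCRETE `A`-fold smoothing
of a box, which needs no calculus:

  `ψ := 𝟙_{[a₀, b₀)} ⋆ u ⋆ ⋯ ⋆ u` (`A` factors), `u = W⁻¹ 𝟙_{[0, W)}`,

realised as the coefficient sequence of the polynomial `P_I · P_u^A`,
`P_I = ∑_{a₀ ≤ m < b₀} X^m`, `P_u = W⁻¹ ∑_{j<W} X^j` (`smoothCutoff a₀ b₀ W A m`), so that additive
convolution is polynomial multiplication and `∑_m ψ(m) e(mθ)` is the value of the polynomial at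
`e(θ)`. Then (all proved below):
* `0 ≤ ψ ≤ 1` (`smoothCutoff_nonneg`, `smoothCutoff_le_one`: the coefficients of `P_u^A` are
  nonnegative and sum to `P_u(1)^A = 1`);
* `ψ = 1` on `[a₀ + A(W-1), b₀)` and `ψ = 0` off `[a₀, b₀ + A(W-1))` (`smoothCutoff_eq_one`,
  `smoothCutoff_eq_zero_of_lt`, `smoothCutoff_eq_zero_of_le`);
* **decay** (`norm_sum_smoothCutoff_fourierChar_le`):
  `‖∑_m ψ(m) e(mθ)‖ ≤ (b₀ - a₀) · (min(W, 1/(2‖θ‖))/W)^A`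
  (`|P_I(e(θ))| ≤ b₀ - a₀` trivially and `|P_u(e(θ))| ≤ min(W, 1/(2‖θ‖))/W` by the geometric sum
  bound, Nathanson Lemma 4.7 = the tree's `Vinogradov.norm_sum_Ioc_fourierChar_le_geomBound`).
For Bourgain one takes `a₀ = M - A(W-1)`, `b₀ = 2M`, `AW ≤ M/2`, so that `ψ = 1` on `[M, 2M)`,
`supp ψ ⊆ [M/2, 5M/2)`, and for `‖θ‖ ≥ 1/M₁` the sum is `≤ (3M/2)(M₁/2W)^A = (3M/2)(2A M^{-ε₁})^A`,
negligible for `A ≍ 1/ε₁`.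

## References

* J. Bourgain, J. Anal. Math. 119 (2013) 147–163, §2, (2.11). [Bourgain2013MoebiusWalsh]
* M. B. Nathanson, *Additive Number Theory: the Classical Bases*, GTM 164, Lemma 4.7 (geometric
  sums). [Nathanson1996]
-/

noncomputable section

open Finset Real Polynomial
open scoped FourierTransform

namespace Literature.NumberTheory.LFunctions.MoebiusWalsh

open Literature.NumberTheory.Sieve.Vinogradov

/-- The box polynomial `P_I = ∑_{m ∈ [a₀, b₀)} X^m` (generating polynomial of `𝟙_{[a₀,b₀)}`).
[folklore] -/
def boxPoly (a₀ b₀ : ℕ) : ℝ[X] := ∑ m ∈ Ico a₀ b₀, (X : ℝ[X]) ^ m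

/-- The averaging polynomial `P_u = W⁻¹ ∑_{j < W} X^j` (generating polynomial of the filter
`u = W⁻¹ 𝟙_{[0,W)}`). [folklore] -/
def avgPoly (W : ℕ) : ℝ[X] := C (1 / (W : ℝ)) * ∑ j ∈ range W, (X : ℝ[X]) ^ j

/-- **The smooth cutoff** `ψ = 𝟙_{[a₀,b₀)} ⋆ u^{⋆A}`, realised as the coefficient sequence of
`P_I · P_u^A`. [cite: Bourgain2013MoebiusWalsh, (2.11) ("a smoothened m-summation")] -/
def smoothCutoff (a₀ b₀ W A : ℕ) (m : ℕ) : ℝ := (boxPoly a₀ b₀ * avgPoly W ^ A).coeff m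

/-- `coeff_n P_I = 𝟙_{[a₀,b₀)}(n)`. [folklore] -/
theorem coeff_boxPoly (a₀ b₀ n : ℕ) :
    (boxPoly a₀ b₀).coeff n = if n ∈ Ico a₀ b₀ then 1 else 0 := by
  unfold boxPoly
  rw [finsetSum_coeff]
  simp_rw [coeff_X_pow]
  rw [Finset.sum_ite_eq]

/-- `coeff_n P_u = W⁻¹ 𝟙_{n < W}`. [folklore] -/
theorem coeff_avgPoly (W n : ℕ) :
    (avgPoly W).coeff n = if n < W then 1 / (W : ℝ) else 0 := by
  unfold avgPoly
  rw [coeff_C_mul, finsetSum_coeff]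
  simp_rw [coeff_X_pow]
  rw [Finset.sum_ite_eq]
  by_cases h : n < W <;> simp [h]

/-- `coeff_n P_u ≥ 0`. [folklore] -/
theorem coeff_avgPoly_nonneg (W n : ℕ) : 0 ≤ (avgPoly W).coeff n := by
  rw [coeff_avgPoly]; split_ifs <;> positivity

/-- Products of real polynomials with nonnegative coefficients have nonnegative coefficients.
[folklore] -/
theorem coeff_mul_nonneg {p q : ℝ[X]} (hp : ∀ i, 0 ≤ p.coeff i) (hq : ∀ j, 0 ≤ q.coeff j) (n : ℕ) :
    0 ≤ (p * q).coeff n := by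
  rw [coeff_mul]
  exact sum_nonneg fun x _ => mul_nonneg (hp _) (hq _)

/-- Powers of a real polynomial with nonnegative coefficients have nonnegative coefficients.
[folklore] -/
theorem coeff_pow_nonneg {p : ℝ[X]} (hp : ∀ i, 0 ≤ p.coeff i) (A n : ℕ) :
    0 ≤ (p ^ A).coeff n := by
  induction A generalizing n with
  | zero => rw [pow_zero, coeff_one]; split_ifs <;> norm_num
  | succ A ih => rw [pow_succ]; exact coeff_mul_nonneg ih hp n

/-- `deg P_u ≤ W - 1`. [folklore] -/
theorem natDegree_avgPoly_le (W : ℕ) : (avgPoly W).natDegree ≤ W - 1 := by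
  unfold avgPoly
  refine (natDegree_C_mul_le _ _).trans ?_
  refine natDegree_sum_le_of_forall_le _ _ fun j hj => ?_
  rw [natDegree_X_pow]
  have := mem_range.mp hj
  omega

/-- `deg P_u^A ≤ A(W - 1)`. [folklore] -/
theorem natDegree_avgPoly_pow_le (W A : ℕ) : (avgPoly W ^ A).natDegree ≤ A * (W - 1) :=
  natDegree_pow_le.trans (Nat.mul_le_mul_left _ (natDegree_avgPoly_le W))

/-- `P_u(1) = 1` (`W ≥ 1`). [folklore] -/
theorem eval_one_avgPoly {W : ℕ} (hW : 0 < W) : (avgPoly W).eval 1 = 1 := by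
  unfold avgPoly
  rw [eval_mul, eval_C, eval_finsetSum]
  simp_rw [eval_pow, eval_X, one_pow]
  rw [sum_const, card_range, nsmul_eq_mul, mul_one]
  have : (W : ℝ) ≠ 0 := by exact_mod_cast hW.ne'
  field_simp

/-- `P_u(1)^A = 1`. [folklore] -/
theorem eval_one_avgPoly_pow {W : ℕ} (hW : 0 < W) (A : ℕ) : (avgPoly W ^ A).eval 1 = 1 := by
  rw [eval_pow, eval_one_avgPoly hW, one_pow]

/-- The coefficients of `P_u^A` sum to `1` (they are `P_u^A` evaluated at `1`). [folklore] -/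
theorem sum_coeff_avgPoly_pow {W : ℕ} (hW : 0 < W) (A : ℕ) {B : ℕ} (hB : A * (W - 1) < B) :
    ∑ j ∈ range B, (avgPoly W ^ A).coeff j = 1 := by
  have h := eval_eq_sum_range' (lt_of_le_of_lt (natDegree_avgPoly_pow_le W A) hB) (1 : ℝ)
  simp_rw [one_pow, mul_one] at h
  rw [← h, eval_one_avgPoly_pow hW]

/-- The cutoff as a convolution: `ψ(m) = ∑_{i+j=m} 𝟙_I(i) c_j`, `c = coeff(P_u^A)`. [folklore] -/
theorem smoothCutoff_eq (a₀ b₀ W A m : ℕ) :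
    smoothCutoff a₀ b₀ W A m =
      ∑ x ∈ Finset.HasAntidiagonal.antidiagonal m, (if x.1 ∈ Ico a₀ b₀ then (avgPoly W ^ A).coeff x.2 else 0) := by
  unfold smoothCutoff
  rw [coeff_mul]
  refine sum_congr rfl fun x _ => ?_
  rw [coeff_boxPoly]
  split_ifs <;> simp

/-- `ψ ≥ 0`. [folklore] -/
theorem smoothCutoff_nonneg (a₀ b₀ W A m : ℕ) : 0 ≤ smoothCutoff a₀ b₀ W A m := by
  rw [smoothCutoff_eq]
  refine sum_nonneg fun x _ => ?_
  split_ifs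
  · exact coeff_pow_nonneg (coeff_avgPoly_nonneg W) A _
  · exact le_rfl

/-- `ψ ≤ 1` (the coefficients of `P_u^A` are `≥ 0` with total mass `1`). [folklore] -/
theorem smoothCutoff_le_one {W : ℕ} (hW : 0 < W) (a₀ b₀ A m : ℕ) :
    smoothCutoff a₀ b₀ W A m ≤ 1 := by
  rw [smoothCutoff_eq]
  have hc := coeff_pow_nonneg (coeff_avgPoly_nonneg W) A
  calc ∑ x ∈ Finset.HasAntidiagonal.antidiagonal m, (if x.1 ∈ Ico a₀ b₀ then (avgPoly W ^ A).coeff x.2 else 0)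
      ≤ ∑ x ∈ Finset.HasAntidiagonal.antidiagonal m, (avgPoly W ^ A).coeff x.2 := by
        refine sum_le_sum fun x _ => ?_
        split_ifs
        · exact le_rfl
        · exact hc _
    _ = ∑ j ∈ range (m + 1), (avgPoly W ^ A).coeff j := by
        rw [← Finset.Nat.sum_antidiagonal_swap, Finset.Nat.sum_antidiagonal_eq_sum_range_succ_mk]
        rfl
    _ ≤ ∑ j ∈ range (m + 1 + A * (W - 1)), (avgPoly W ^ A).coeff j :=
        sum_le_sum_of_subset_of_nonneg (range_subset_range.mpr (by omega)) fun _ _ _ => hc _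
    _ = 1 := sum_coeff_avgPoly_pow hW A (by omega)

/-- **The plateau**: `ψ = 1` on `[a₀ + A(W-1), b₀)` (all the mass of `u^{⋆A}` lands in the box).
[folklore] -/
theorem smoothCutoff_eq_one {W : ℕ} (hW : 0 < W) {a₀ b₀ A m : ℕ} (h1 : a₀ + A * (W - 1) ≤ m)
    (h2 : m < b₀) : smoothCutoff a₀ b₀ W A m = 1 := by
  rw [smoothCutoff_eq]
  have hdeg := natDegree_avgPoly_pow_le W A
  calc ∑ x ∈ Finset.HasAntidiagonal.antidiagonal m, (if x.1 ∈ Ico a₀ b₀ then (avgPoly W ^ A).coeff x.2 else 0)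
      = ∑ x ∈ Finset.HasAntidiagonal.antidiagonal m, (avgPoly W ^ A).coeff x.2 := by
        refine sum_congr rfl fun x hx => ?_
        rw [Finset.HasAntidiagonal.mem_antidiagonal] at hx
        split_ifs with h
        · rfl
        · symm
          apply coeff_eq_zero_of_natDegree_lt
          rw [mem_Ico] at h
          omega
    _ = ∑ j ∈ range (m + 1), (avgPoly W ^ A).coeff j := by
        rw [← Finset.Nat.sum_antidiagonal_swap, Finset.Nat.sum_antidiagonal_eq_sum_range_succ_mk]
        rfl
    _ = 1 := sum_coeff_avgPoly_pow hW A (by omega)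

/-- **The support**: `ψ(m) = 0` for `m < a₀`. [folklore] -/
theorem smoothCutoff_eq_zero_of_lt {a₀ b₀ W A m : ℕ} (hm : m < a₀) :
    smoothCutoff a₀ b₀ W A m = 0 := by
  rw [smoothCutoff_eq]
  refine sum_eq_zero fun x hx => ?_
  rw [Finset.HasAntidiagonal.mem_antidiagonal] at hx
  rw [if_neg]
  rw [mem_Ico]; omega

/-- **The support**: `ψ(m) = 0` for `m ≥ b₀ + A(W-1)`. [folklore] -/
theorem smoothCutoff_eq_zero_of_le {a₀ b₀ W A m : ℕ} (hm : b₀ + A * (W - 1) ≤ m) :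
    smoothCutoff a₀ b₀ W A m = 0 := by
  rw [smoothCutoff_eq]
  have hdeg := natDegree_avgPoly_pow_le W A
  refine sum_eq_zero fun x hx => ?_
  rw [Finset.HasAntidiagonal.mem_antidiagonal] at hx
  split_ifs with h
  · apply coeff_eq_zero_of_natDegree_lt
    rw [mem_Ico] at h
    omega
  · rfl

/-! ### Fourier transform -/

/-- `‖P_I(e(θ))‖ ≤ b₀ - a₀` (trivial bound). [folklore] -/
theorem norm_eval₂_boxPoly_le (a₀ b₀ : ℕ) (θ : ℝ) :
    ‖(boxPoly a₀ b₀).eval₂ Complex.ofRealHom (𝐞 θ : ℂ)‖ ≤ ((b₀ - a₀ : ℕ) : ℝ) := by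
  unfold boxPoly
  rw [eval₂_finsetSum]
  simp_rw [eval₂_X_pow]
  calc ‖∑ m ∈ Ico a₀ b₀, (𝐞 θ : ℂ) ^ m‖ ≤ ∑ m ∈ Ico a₀ b₀, ‖(𝐞 θ : ℂ) ^ m‖ := norm_sum_le _ _
    _ = ((b₀ - a₀ : ℕ) : ℝ) := by
        simp [norm_pow]

/-- `‖P_u(e(θ))‖ ≤ min(W, 1/(2‖θ‖)) / W` (geometric sum, Nathanson Lemma 4.7).
[cite: Nathanson1996, Lemma 4.7] -/
theorem norm_eval₂_avgPoly_le {W : ℕ} (hW : 0 < W) (θ : ℝ) :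
    ‖(avgPoly W).eval₂ Complex.ofRealHom (𝐞 θ : ℂ)‖ ≤ geomBound W θ / W := by
  unfold avgPoly
  rw [eval₂_mul, eval₂_C, eval₂_finsetSum]
  simp_rw [eval₂_X_pow]
  have hW0 : (0 : ℝ) < W := by exact_mod_cast hW
  -- `‖∑_{j<W} z^j‖ = ‖∑_{j ∈ Ioc 0 W} e(jθ)‖ ≤ geomBound W θ`
  have hgeom : ‖∑ j ∈ range W, (𝐞 θ : ℂ) ^ j‖ ≤ geomBound W θ := by
    have h1 : (𝐞 θ : ℂ) * ∑ j ∈ range W, (𝐞 θ : ℂ) ^ j =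
        ∑ n ∈ Ioc 0 W, (𝐞 ((n : ℝ) * θ) : ℂ) := by
      rw [mul_sum]
      have : Ioc 0 W = Ico (0 + 1) (W + 1) := by
        ext n; simp only [mem_Ioc, mem_Ico]; omega
      rw [this, sum_Ico_eq_sum_range, show W + 1 - (0 + 1) = W by omega]
      refine sum_congr rfl fun j _ => ?_
      rw [Literature.NumberTheory.Sieve.Vinogradov.fourierChar_natCast_mul, ← pow_succ',
        show 0 + 1 + j = j + 1 by omega]
    have h2 : ‖(𝐞 θ : ℂ) * ∑ j ∈ range W, (𝐞 θ : ℂ) ^ j‖ = ‖∑ j ∈ range W, (𝐞 θ : ℂ) ^ j‖ := by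
      rw [norm_mul, Circle.norm_coe, one_mul]
    rw [← h2, h1]
    exact norm_sum_Ioc_fourierChar_le_geomBound θ (by simp)
  rw [norm_mul]
  have hC : ‖Complex.ofRealHom (1 / (W : ℝ))‖ = 1 / (W : ℝ) := by
    rw [Complex.ofRealHom_eq_coe]
    push_cast
    rw [norm_div, norm_one, Complex.norm_natCast]
  rw [hC]
  calc 1 / (W : ℝ) * ‖∑ j ∈ range W, (𝐞 θ : ℂ) ^ j‖ ≤ 1 / (W : ℝ) * geomBound W θ :=
        mul_le_mul_of_nonneg_left hgeom (by positivity)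
    _ = geomBound W θ / W := by ring

/-- **Exponential sums of the smooth cutoff decay polynomially** (any order `A`): for
`B ≥ b₀ + A(W-1)` (beyond the support),
`‖∑_{m<B} ψ(m) e(mθ)‖ ≤ (b₀ - a₀) (min(W, 1/(2‖θ‖))/W)^A`
— the sum is `P_I(e(θ)) · P_u(e(θ))^A`. [cite: Bourgain2013MoebiusWalsh, (2.11) ("a smoothened m-summation … up to a negligible error term")] -/
theorem norm_sum_smoothCutoff_fourierChar_le {W : ℕ} (hW : 0 < W) (a₀ b₀ A : ℕ) {B : ℕ}
    (hB : b₀ + A * (W - 1) ≤ B) (θ : ℝ) :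
    ‖∑ m ∈ range B, (smoothCutoff a₀ b₀ W A m : ℂ) * (𝐞 ((m : ℝ) * θ) : ℂ)‖ ≤
      ((b₀ - a₀ : ℕ) : ℝ) * (geomBound W θ / W) ^ A := by
  rcases le_or_gt b₀ a₀ with hab | hab
  · -- empty box: everything vanishes
    have h0 : ∀ m, smoothCutoff a₀ b₀ W A m = 0 := by
      intro m
      rcases lt_or_ge m a₀ with hm | hm
      · exact smoothCutoff_eq_zero_of_lt hm
      · unfold smoothCutoff boxPoly
        rw [Ico_eq_empty_of_le hab, sum_empty, zero_mul, coeff_zero]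
    simp_rw [h0]
    simp only [Complex.ofReal_zero, zero_mul, sum_const_zero, norm_zero]
    exact mul_nonneg (Nat.cast_nonneg _) (pow_nonneg (div_nonneg
      (geomBound_nonneg (Nat.cast_nonneg W) θ) (Nat.cast_nonneg W)) A)
  -- the sum is the polynomial evaluated at `e(θ)`
  set p : ℝ[X] := boxPoly a₀ b₀ * avgPoly W ^ A with hp
  have hdeg : p.natDegree < B := by
    have h1 : (boxPoly a₀ b₀).natDegree ≤ b₀ - 1 := by
      unfold boxPoly
      refine natDegree_sum_le_of_forall_le _ _ fun m hm => ?_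
      rw [natDegree_X_pow]; have := (mem_Ico.mp hm).2; omega
    have h2 := natDegree_avgPoly_pow_le W A
    calc p.natDegree ≤ (boxPoly a₀ b₀).natDegree + (avgPoly W ^ A).natDegree := natDegree_mul_le
      _ < B := by omega
  have heval : ∑ m ∈ range B, (smoothCutoff a₀ b₀ W A m : ℂ) * (𝐞 ((m : ℝ) * θ) : ℂ) =
      p.eval₂ Complex.ofRealHom (𝐞 θ : ℂ) := by
    rw [eval₂_eq_sum_range' Complex.ofRealHom hdeg]
    refine sum_congr rfl fun m _ => ?_
    rw [Literature.NumberTheory.Sieve.Vinogradov.fourierChar_natCast_mul]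
    rfl
  rw [heval, hp, eval₂_mul, eval₂_pow, norm_mul, norm_pow]
  have hg : 0 ≤ geomBound W θ / W :=
    div_nonneg (geomBound_nonneg (Nat.cast_nonneg W) θ) (Nat.cast_nonneg W)
  exact mul_le_mul (norm_eval₂_boxPoly_le a₀ b₀ θ)
    (pow_le_pow_left₀ (norm_nonneg _) (norm_eval₂_avgPoly_le hW θ) A) (by positivity)
    (Nat.cast_nonneg _)

end Literature.NumberTheory.LFunctions.MoebiusWalsh
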